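import Summits.CriticalPhenomena.PercolationContinuityZ3.Theorems.PercNearOneGluingNoHeavyLowerTailSahiLatinSections
import Summits.CriticalPhenomena.PercolationContinuityZ3.Theorems.PercNearOneGluingNoHeavyLowerTailSahiLatinRelabel

/-!
# `NoHeavyLowerTail` (crux stmt-CriticalPhenomena-4575), Sahi programme (prim-master-conj gen 46): **CHARGE MONOTONICITY** —
# for up-sets `b, c ⊆ [3]^ι` the charge `Φ_{bc}` of the Latin kernel is NON-DECREASING on the up-set `b ∩ c`

Support file (`--supports stmt-CriticalPhenomena-4575`; companion of `…SahiLatinKernel/Moves/Relabel/Sections`; memo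
`run/shared/lean/prim/prim-l12/FROM-prim-master-conj-g46-CHARGE-MONOTONICITY.md`; sequel `…SahiLatinReflection`).  Nothing here is
specific to percolation; nothing is asserted about the crux.

THE MATHEMATICS (all `d`; everything PROVED, axioms standard).  Recall the first-point form `κ(a,b,c) = Σ_{u∈a} Φ_{bc}(u)` of the Latin
kernel (`kappa_eq_sum_Phi`), LEMMA R (`Φ_{bc} ≥ 0` on `b ∩ c`, `Phi_nonneg_of_mem`) and LEMMA A (`Φ_{bc} ≤ 0` off `b ∩ c` for up-sets,
`Phi_nonpos_of_not_mem`).  Single out an axis (index type `Option κ`, axis `none`, `glue`/`sec` of `…SahiLatinSections`).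
* §1 `Phi_eq_kappa_singleton` (`Φ_{bc}(u) = κ({u},b,c)`), the Latin functionals with a singleton slot (`latinPairs {x} t = N_t(x)`,
  `latinTriples {x} t v = Λ_{tv}(x)`, …), `N_mono`, and **`Lam_add_N_le_left/right`**: `Λ` grows no faster than `N` in each argument.
* §2 the ONE-AXIS FORMULAS `Phi_glue_zero/one/two`: the charge at `glue l x'` in terms of the link counts `N`, `Λ` (dimension `κ`) of the
  SECTIONS `b_m = sec b m`, `c_m`: with `{p,q} = {0,1,2} ∖ {l}`,
  `Φ_{bc}(glue l x') = 2^{d'+2}[x'∈b_l∩c_l] − N_{(bc)_p} − N_{(bc)_q} + Λ_{b_pc_q} + Λ_{b_qc_p} − [x'∈c_l](N_{b_p}+N_{b_q}) − [x'∈b_l](N_{c_p}+N_{c_q})`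
  (from the letter expansion `kappa_option` on a singleton first slot).
* §3 **CHARGE MONOTONICITY** `Phi_glue_zero_le_one`, `Phi_glue_one_le_two`, `Phi_glue_le_of_le`: for up-sets `b, c`, if `glue l x' ∈ b ∩ c`
  and `l ≤ l'` then `Φ_{bc}(glue l x') ≤ Φ_{bc}(glue l' x')`.  So `Φ_{bc}` restricted to the up-set `b ∩ c` is order-preserving along the axis
  (by re-indexing `…SahiLatinReindex`, along every axis, hence order-preserving on `b ∩ c`); off `b ∩ c` it is NOT monotone (census `d = 3`,
  memo).  PROOF: in the difference the `N`-terms of `b`, `c`, `b ∩ c` enter with the favourable sign (nested sections) and dominate the two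
  `Λ`-differences by `Lam_add_N_le_left/right`; indeed `Φ(glue l' x') − Φ(glue l x') ≥ N_{(bc)_{l'}}(x') − N_{(bc)_l}(x') ≥ 0`.
Numerics (memo): `d = 3` exhaustive (12.9·10⁶ comparable pairs inside the meet), `d = 4` sampled (1.1·10⁶): minimum difference `0`.
HONEST LABEL: a structure theorem about the kernel; `LatinPos ι` (FBP(3,d), `d ≥ 5`), Sahi's `C₃` and Kahn's conjecture remain OPEN. [this work]
-/
namespace Summit.CriticalPhenomena.PercolationContinuityZ3.Theorems.SahiLatin

open Finset

section General

variable {ι : Type*} [Fintype ι] [DecidableEq ι]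

/-! ## §1  Functionals with a singleton slot; `Λ` versus `N` -/

/-- The charge is the kernel with a singleton first slot: `Φ_{bc}(u) = κ({u}, b, c)`. [this work] -/
theorem Phi_eq_kappa_singleton (b c : Finset (Pt ι)) (u : Pt ι) : Phi b c u = kappa {u} b c := by
  rw [kappa_eq_sum_Phi, sum_singleton]

/-- `N_s(u)` as an indicator sum over the link. [this work] -/
theorem N_eq_sum_ind (s : Finset (Pt ι)) (u : Pt ι) : (N s u : ℤ) = ∑ y ∈ link u, ind s y := by
  rw [N, ← sum_boole]; rfl

/-- `Λ_{bc}(u)` as an indicator sum over the link. [this work] -/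
theorem Lam_eq_sum_ind (b c : Finset (Pt ι)) (u : Pt ι) : (Lam b c u : ℤ) = ∑ y ∈ link u, ind b y * ind c (anti u y) := by
  rw [Lam, ← sum_boole]
  refine sum_congr rfl fun y _ => ?_
  by_cases hb : y ∈ b <;> by_cases hc : anti u y ∈ c <;> simp [ind, hb, hc]

/-- `latinPairs {x} t = N_t(x)`. [this work] -/
theorem latinPairs_singleton_left (x : Pt ι) (t : Finset (Pt ι)) : latinPairs {x} t = N t x := by
  unfold latinPairs
  rw [sum_lperm_eq_sum_link (fun p q _ => ind {x} p * ind t q), N_eq_sum_ind]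
  rw [Fintype.sum_eq_single x]
  · rw [ind_of_mem (mem_singleton_self x)]
    simp only [one_mul]
  · intro u hu
    rw [ind_of_not_mem (fun h => hu (mem_singleton.1 h))]
    simp only [zero_mul, sum_const_zero]

/-- `latinPairs t {x} = N_t(x)`. [this work] -/
theorem latinPairs_singleton_right (t : Finset (Pt ι)) (x : Pt ι) : latinPairs t {x} = N t x := by
  rw [latinPairs_comm, latinPairs_singleton_left]

/-- `latinTriples {x} t v = Λ_{tv}(x)`. [this work] -/
theorem latinTriples_singleton_left (x : Pt ι) (t v : Finset (Pt ι)) : latinTriples {x} t v = Lam t v x := by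
  unfold latinTriples
  rw [sum_lperm_eq_sum_link (fun p q r => ind {x} p * ind t q * ind v r), Lam_eq_sum_ind]
  rw [Fintype.sum_eq_single x]
  · rw [ind_of_mem (mem_singleton_self x)]
    simp only [one_mul]
  · intro u hu
    rw [ind_of_not_mem (fun h => hu (mem_singleton.1 h))]
    simp only [zero_mul, sum_const_zero]

/-- `S1` of a singleton cut by two sets. [this work] -/
theorem S1_singleton_inter (x : Pt ι) (s t : Finset (Pt ι)) :
    S1 ({x} ∩ s ∩ t) = 2 ^ Fintype.card ι * (ind s x * ind t x) := by
  rw [S1_eq]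
  by_cases hs : x ∈ s
  · by_cases ht : x ∈ t
    · rw [inter_assoc, singleton_inter_of_mem (mem_inter.2 ⟨hs, ht⟩), card_singleton, ind_of_mem hs, ind_of_mem ht]; push_cast; ring
    · rw [inter_assoc, singleton_inter_of_notMem (fun h => ht (mem_inter.1 h).2), card_empty, ind_of_not_mem ht]; push_cast; ring
  · rw [inter_assoc, singleton_inter_of_notMem (fun h => hs (mem_inter.1 h).1), card_empty, ind_of_not_mem hs]; push_cast; ring

/-- `latinPairs s ({x} ∩ t) = [x ∈ t]·N_s(x)`. [this work] -/
theorem latinPairs_singleton_inter_right (s : Finset (Pt ι)) (x : Pt ι) (t : Finset (Pt ι)) :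
    latinPairs s ({x} ∩ t) = ind t x * N s x := by
  by_cases ht : x ∈ t
  · rw [singleton_inter_of_mem ht, latinPairs_singleton_right, ind_of_mem ht, one_mul]
  · rw [singleton_inter_of_notMem ht, ind_of_not_mem ht, zero_mul]
    unfold latinPairs
    simp [ind]

/-- `S1 ∅ = 0`-type vanishing: `S1 (∅ ∩ s ∩ t) = 0`. [this work] -/
theorem S1_empty_inter (s t : Finset (Pt ι)) : S1 ((∅ : Finset (Pt ι)) ∩ s ∩ t) = 0 := by
  rw [empty_inter, empty_inter, S1_eq, card_empty]; simp

/-- `latinPairs ∅ t = 0` (local copy of the lemma of `…SahiLatinCylinder`, to keep the import light). [this work] -/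
private theorem latinPairs_empty_left' (t : Finset (Pt ι)) : latinPairs (∅ : Finset (Pt ι)) t = 0 := by
  unfold latinPairs; simp [ind]

/-- `latinPairs s (∅ ∩ t) = 0`. [this work] -/
theorem latinPairs_empty_inter_right (s t : Finset (Pt ι)) : latinPairs s ((∅ : Finset (Pt ι)) ∩ t) = 0 := by
  rw [empty_inter]; unfold latinPairs; simp [ind]

/-- `latinTriples ∅ t v = 0`. [this work] -/
theorem latinTriples_empty_left (t v : Finset (Pt ι)) : latinTriples (∅ : Finset (Pt ι)) t v = 0 := by
  unfold latinTriples; simp [ind]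

/-- `N` is monotone in the set. [this work] -/
theorem N_mono {s t : Finset (Pt ι)} (h : s ⊆ t) (u : Pt ι) : N s u ≤ N t u := by
  unfold N
  exact card_le_card (fun y hy => by
    rw [mem_filter] at hy ⊢
    exact ⟨hy.1, h hy.2⟩)

/-- **`Λ` grows no faster than `N` in its first argument**: for `s ⊆ s'`, `Λ_{s't}(u) + N_s(u) ≤ Λ_{st}(u) + N_{s'}(u)`. [this work] -/
theorem Lam_add_N_le_left {s s' : Finset (Pt ι)} (h : s ⊆ s') (t : Finset (Pt ι)) (u : Pt ι) :
    Lam s' t u + N s u ≤ Lam s t u + N s' u := by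
  unfold Lam N
  -- split the filters of `s'` by membership in `s`
  have e1 : ((link u).filter fun y => y ∈ s' ∧ anti u y ∈ t).card =
      ((link u).filter fun y => y ∈ s ∧ anti u y ∈ t).card +
        ((link u).filter fun y => (y ∈ s' ∧ y ∉ s) ∧ anti u y ∈ t).card := by
    rw [← card_union_of_disjoint]
    · congr 1
      ext y
      simp only [mem_filter, mem_union]
      constructor
      · rintro ⟨hy, hs', ht⟩
        by_cases hs : y ∈ s
        · exact Or.inl ⟨hy, hs, ht⟩
        · exact Or.inr ⟨hy, ⟨hs', hs⟩, ht⟩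
      · rintro (⟨hy, hs, ht⟩ | ⟨hy, ⟨hs', _⟩, ht⟩)
        · exact ⟨hy, h hs, ht⟩
        · exact ⟨hy, hs', ht⟩
    · rw [disjoint_filter]
      intro y _ h1 h2
      exact h2.1.2 h1.1
  have e2 : ((link u).filter fun y => y ∈ s').card =
      ((link u).filter fun y => y ∈ s).card + ((link u).filter fun y => y ∈ s' ∧ y ∉ s).card := by
    rw [← card_union_of_disjoint]
    · congr 1
      ext y
      simp only [mem_filter, mem_union]
      constructor
      · rintro ⟨hy, hs'⟩
        by_cases hs : y ∈ s
        · exact Or.inl ⟨hy, hs⟩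
        · exact Or.inr ⟨hy, hs', hs⟩
      · rintro (⟨hy, hs⟩ | ⟨hy, hs', _⟩)
        · exact ⟨hy, h hs⟩
        · exact ⟨hy, hs'⟩
    · rw [disjoint_filter]
      intro y _ h1 h2
      exact h2.2 h1
  have e3 : ((link u).filter fun y => (y ∈ s' ∧ y ∉ s) ∧ anti u y ∈ t).card ≤
      ((link u).filter fun y => y ∈ s' ∧ y ∉ s).card :=
    card_le_card (fun y hy => by
      rw [mem_filter] at hy ⊢
      exact ⟨hy.1, hy.2.1⟩)
  omega

/-- **`Λ` grows no faster than `N` in its second argument**: for `t ⊆ t'`, `Λ_{st'}(u) + N_t(u) ≤ Λ_{st}(u) + N_{t'}(u)`. [this work] -/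
theorem Lam_add_N_le_right (s : Finset (Pt ι)) {t t' : Finset (Pt ι)} (h : t ⊆ t') (u : Pt ι) :
    Lam s t' u + N t u ≤ Lam s t u + N t' u := by
  rw [Lam_comm s t', Lam_comm s t]
  exact Lam_add_N_le_left h s u

end General

/-! ## §2  The charge at a glued point in terms of the sections -/

section Axis

variable {κ : Type*} [Fintype κ] [DecidableEq κ]

/-- The section of the singleton `{glue l x'}` at its own level. [this work] -/
theorem sec_singleton_glue_self (l : Fin 3) (x' : Pt κ) : sec ({glue l x'} : Finset (Pt (Option κ))) l = {x'} := by
  ext y'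
  rw [mem_sec, mem_singleton, mem_singleton]
  constructor
  · intro h; exact (glue_inj h).2
  · intro h; rw [h]

/-- The section of the singleton `{glue l x'}` at another level is empty. [this work] -/
theorem sec_singleton_glue_ne {l l' : Fin 3} (h : l' ≠ l) (x' : Pt κ) : sec ({glue l x'} : Finset (Pt (Option κ))) l' = ∅ := by
  ext y'
  rw [mem_sec, mem_singleton]
  simp only [notMem_empty, iff_false]
  intro h'
  exact h (glue_inj h').1

omit [DecidableEq κ] in
/-- The dimension count: `|Option κ| = |κ| + 1`. [this work] -/
theorem two_pow_card_option : (2 : ℤ) ^ Fintype.card (Option κ) = 2 * 2 ^ Fintype.card κ := by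
  rw [Fintype.card_option, pow_succ]; ring

/-- **The charge at level `0`** of the axis `none`, in terms of the sections (`x_l = sec x l`, link counts in dimension `κ`):
`Φ_{bc}(glue 0 x') = 2^{d'+2}[x'∈b₀∩c₀] − N_{(bc)₁} − N_{(bc)₂} + Λ_{b₁c₂} + Λ_{b₂c₁} − [x'∈c₀](N_{b₁}+N_{b₂}) − [x'∈b₀](N_{c₁}+N_{c₂})`. [this work] -/
theorem Phi_glue_zero (b c : Finset (Pt (Option κ))) (x' : Pt κ) :
    Phi b c (glue 0 x') =
      2 * (2 * 2 ^ Fintype.card κ) * (ind (sec b 0) x' * ind (sec c 0) x')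
        - (N (sec b 1 ∩ sec c 1) x' : ℤ) - (N (sec b 2 ∩ sec c 2) x' : ℤ)
        + (Lam (sec b 1) (sec c 2) x' : ℤ) + (Lam (sec b 2) (sec c 1) x' : ℤ)
        - ind (sec c 0) x' * ((N (sec b 1) x' : ℤ) + N (sec b 2) x')
        - ind (sec b 0) x' * ((N (sec c 1) x' : ℤ) + N (sec c 2) x') := by
  rw [Phi_eq_kappa_singleton, kappa_option]
  rw [sum_perm3 (fun i j k => 2 * S1 (sec {glue 0 x'} i ∩ sec b i ∩ sec c i)
        - latinPairs (sec {glue 0 x'} i) (sec b j ∩ sec c j)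
        - latinPairs (sec b i) (sec {glue 0 x'} j ∩ sec c j)
        - latinPairs (sec c i) (sec {glue 0 x'} j ∩ sec b j)
        + latinTriples (sec {glue 0 x'} i) (sec b j) (sec c k))]
  have h1 : (1 : Fin 3) ≠ 0 := by decide
  have h2 : (2 : Fin 3) ≠ 0 := by decide
  simp only [sec_singleton_glue_self, sec_singleton_glue_ne h1, sec_singleton_glue_ne h2, S1_singleton_inter, S1_empty_inter,
    latinPairs_singleton_left, latinPairs_empty_left', latinPairs_singleton_inter_right, latinPairs_empty_inter_right,
    latinTriples_singleton_left, latinTriples_empty_left]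
  rw [N_inter, N_inter]
  push_cast
  ring

/-- **The charge at level `1`**:
`Φ_{bc}(glue 1 x') = 2^{d'+2}[x'∈b₁∩c₁] − N_{(bc)₀} − N_{(bc)₂} + Λ_{b₀c₂} + Λ_{b₂c₀} − [x'∈c₁](N_{b₀}+N_{b₂}) − [x'∈b₁](N_{c₀}+N_{c₂})`. [this work] -/
theorem Phi_glue_one (b c : Finset (Pt (Option κ))) (x' : Pt κ) :
    Phi b c (glue 1 x') =
      2 * (2 * 2 ^ Fintype.card κ) * (ind (sec b 1) x' * ind (sec c 1) x')
        - (N (sec b 0 ∩ sec c 0) x' : ℤ) - (N (sec b 2 ∩ sec c 2) x' : ℤ)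
        + (Lam (sec b 0) (sec c 2) x' : ℤ) + (Lam (sec b 2) (sec c 0) x' : ℤ)
        - ind (sec c 1) x' * ((N (sec b 0) x' : ℤ) + N (sec b 2) x')
        - ind (sec b 1) x' * ((N (sec c 0) x' : ℤ) + N (sec c 2) x') := by
  rw [Phi_eq_kappa_singleton, kappa_option]
  rw [sum_perm3 (fun i j k => 2 * S1 (sec {glue 1 x'} i ∩ sec b i ∩ sec c i)
        - latinPairs (sec {glue 1 x'} i) (sec b j ∩ sec c j)
        - latinPairs (sec b i) (sec {glue 1 x'} j ∩ sec c j)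
        - latinPairs (sec c i) (sec {glue 1 x'} j ∩ sec b j)
        + latinTriples (sec {glue 1 x'} i) (sec b j) (sec c k))]
  have h0 : (0 : Fin 3) ≠ 1 := by decide
  have h2 : (2 : Fin 3) ≠ 1 := by decide
  simp only [sec_singleton_glue_self, sec_singleton_glue_ne h0, sec_singleton_glue_ne h2, S1_singleton_inter, S1_empty_inter,
    latinPairs_singleton_left, latinPairs_empty_left', latinPairs_singleton_inter_right, latinPairs_empty_inter_right,
    latinTriples_singleton_left, latinTriples_empty_left]
  rw [N_inter, N_inter]
  push_cast
  ring

/-- **The charge at level `2`**: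
`Φ_{bc}(glue 2 x') = 2^{d'+2}[x'∈b₂∩c₂] − N_{(bc)₀} − N_{(bc)₁} + Λ_{b₀c₁} + Λ_{b₁c₀} − [x'∈c₂](N_{b₀}+N_{b₁}) − [x'∈b₂](N_{c₀}+N_{c₁})`. [this work] -/
theorem Phi_glue_two (b c : Finset (Pt (Option κ))) (x' : Pt κ) :
    Phi b c (glue 2 x') =
      2 * (2 * 2 ^ Fintype.card κ) * (ind (sec b 2) x' * ind (sec c 2) x')
        - (N (sec b 0 ∩ sec c 0) x' : ℤ) - (N (sec b 1 ∩ sec c 1) x' : ℤ)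
        + (Lam (sec b 0) (sec c 1) x' : ℤ) + (Lam (sec b 1) (sec c 0) x' : ℤ)
        - ind (sec c 2) x' * ((N (sec b 0) x' : ℤ) + N (sec b 1) x')
        - ind (sec b 2) x' * ((N (sec c 0) x' : ℤ) + N (sec c 1) x') := by
  rw [Phi_eq_kappa_singleton, kappa_option]
  rw [sum_perm3 (fun i j k => 2 * S1 (sec {glue 2 x'} i ∩ sec b i ∩ sec c i)
        - latinPairs (sec {glue 2 x'} i) (sec b j ∩ sec c j)
        - latinPairs (sec b i) (sec {glue 2 x'} j ∩ sec c j)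
        - latinPairs (sec c i) (sec {glue 2 x'} j ∩ sec b j)
        + latinTriples (sec {glue 2 x'} i) (sec b j) (sec c k))]
  have h0 : (0 : Fin 3) ≠ 2 := by decide
  have h1 : (1 : Fin 3) ≠ 2 := by decide
  simp only [sec_singleton_glue_self, sec_singleton_glue_ne h0, sec_singleton_glue_ne h1, S1_singleton_inter, S1_empty_inter,
    latinPairs_singleton_left, latinPairs_empty_left', latinPairs_singleton_inter_right, latinPairs_empty_inter_right,
    latinTriples_singleton_left, latinTriples_empty_left]
  rw [N_inter, N_inter]
  push_cast
  ring

/-! ## §3  CHARGE MONOTONICITY on the meet -/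

/-- **CHARGE MONOTONICITY, levels `0 → 1`** (all `κ`): for up-sets `b, c`, if `glue 0 x' ∈ b ∩ c` then
`Φ_{bc}(glue 0 x') ≤ Φ_{bc}(glue 1 x')`; indeed the difference is at least `N_{(bc)₁}(x') − N_{(bc)₀}(x') ≥ 0`. [this work] -/
theorem Phi_glue_zero_le_one {b c : Finset (Pt (Option κ))} (hb : IsUpperSet (b : Set (Pt (Option κ))))
    (hc : IsUpperSet (c : Set (Pt (Option κ)))) {x' : Pt κ} (hxb : glue 0 x' ∈ b) (hxc : glue 0 x' ∈ c) :
    Phi b c (glue 0 x') ≤ Phi b c (glue 1 x') := by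
  have h01 : (0 : Fin 3) ≤ 1 := by decide
  have h12 : (1 : Fin 3) ≤ 2 := by decide
  have hb01 : sec b 0 ⊆ sec b 1 := sec_mono hb h01
  have hc01 : sec c 0 ⊆ sec c 1 := sec_mono hc h01
  have hb12 : sec b 1 ⊆ sec b 2 := sec_mono hb h12
  have hc12 : sec c 1 ⊆ sec c 2 := sec_mono hc h12
  have hxb0 : x' ∈ sec b 0 := mem_sec.2 hxb
  have hxc0 : x' ∈ sec c 0 := mem_sec.2 hxc
  have hxb1 : x' ∈ sec b 1 := hb01 hxb0
  have hxc1 : x' ∈ sec c 1 := hc01 hxc0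
  have e1 : (N (sec b 0 ∩ sec c 0) x' : ℤ) ≤ N (sec b 1 ∩ sec c 1) x' := by
    exact_mod_cast N_mono (inter_subset_inter hb01 hc01) x'
  have e2 : (Lam (sec b 1) (sec c 2) x' : ℤ) + N (sec b 0) x' ≤ Lam (sec b 0) (sec c 2) x' + N (sec b 1) x' := by
    exact_mod_cast Lam_add_N_le_left hb01 (sec c 2) x'
  have e3 : (Lam (sec b 2) (sec c 1) x' : ℤ) + N (sec c 0) x' ≤ Lam (sec b 2) (sec c 0) x' + N (sec c 1) x' := by
    exact_mod_cast Lam_add_N_le_right (sec b 2) hc01 x'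
  rw [Phi_glue_zero, Phi_glue_one, ind_of_mem hxb0, ind_of_mem hxc0, ind_of_mem hxb1, ind_of_mem hxc1]
  linarith

/-- **CHARGE MONOTONICITY, levels `1 → 2`** (all `κ`): for up-sets `b, c`, if `glue 1 x' ∈ b ∩ c` then
`Φ_{bc}(glue 1 x') ≤ Φ_{bc}(glue 2 x')`. [this work] -/
theorem Phi_glue_one_le_two {b c : Finset (Pt (Option κ))} (hb : IsUpperSet (b : Set (Pt (Option κ))))
    (hc : IsUpperSet (c : Set (Pt (Option κ)))) {x' : Pt κ} (hxb : glue 1 x' ∈ b) (hxc : glue 1 x' ∈ c) :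
    Phi b c (glue 1 x') ≤ Phi b c (glue 2 x') := by
  have h01 : (0 : Fin 3) ≤ 1 := by decide
  have h12 : (1 : Fin 3) ≤ 2 := by decide
  have hb01 : sec b 0 ⊆ sec b 1 := sec_mono hb h01
  have hc01 : sec c 0 ⊆ sec c 1 := sec_mono hc h01
  have hb12 : sec b 1 ⊆ sec b 2 := sec_mono hb h12
  have hc12 : sec c 1 ⊆ sec c 2 := sec_mono hc h12
  have hxb1 : x' ∈ sec b 1 := mem_sec.2 hxb
  have hxc1 : x' ∈ sec c 1 := mem_sec.2 hxc
  have hxb2 : x' ∈ sec b 2 := hb12 hxb1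
  have hxc2 : x' ∈ sec c 2 := hc12 hxc1
  have e1 : (N (sec b 1 ∩ sec c 1) x' : ℤ) ≤ N (sec b 2 ∩ sec c 2) x' := by
    exact_mod_cast N_mono (inter_subset_inter hb12 hc12) x'
  have e2 : (Lam (sec b 0) (sec c 2) x' : ℤ) + N (sec c 1) x' ≤ Lam (sec b 0) (sec c 1) x' + N (sec c 2) x' := by
    exact_mod_cast Lam_add_N_le_right (sec b 0) hc12 x'
  have e3 : (Lam (sec b 2) (sec c 0) x' : ℤ) + N (sec b 1) x' ≤ Lam (sec b 1) (sec c 0) x' + N (sec b 2) x' := by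
    exact_mod_cast Lam_add_N_le_left hb12 (sec c 0) x'
  rw [Phi_glue_one, Phi_glue_two, ind_of_mem hxb1, ind_of_mem hxc1, ind_of_mem hxb2, ind_of_mem hxc2]
  linarith

/-- **CHARGE MONOTONICITY along the axis** (all `κ`): for up-sets `b, c`, levels `l ≤ l'` and `glue l x' ∈ b ∩ c`,
`Φ_{bc}(glue l x') ≤ Φ_{bc}(glue l' x')` — the charge restricted to the up-set `b ∩ c` is order-preserving along the axis `none`
(by re-indexing, along every axis; hence order-preserving on `b ∩ c`). [this work] -/
theorem Phi_glue_le_of_le {b c : Finset (Pt (Option κ))} (hb : IsUpperSet (b : Set (Pt (Option κ))))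
    (hc : IsUpperSet (c : Set (Pt (Option κ)))) {l l' : Fin 3} (hll : l ≤ l') {x' : Pt κ} (hxb : glue l x' ∈ b)
    (hxc : glue l x' ∈ c) : Phi b c (glue l x') ≤ Phi b c (glue l' x') := by
  have up : ∀ {s : Finset (Pt (Option κ))}, IsUpperSet (s : Set (Pt (Option κ))) → ∀ {m m' : Fin 3}, m ≤ m' →
      glue m x' ∈ s → glue m' x' ∈ s := fun hs m m' hmm h => hs (glue_le_glue_iff.2 ⟨hmm, le_rfl⟩) h
  fin_cases l <;> fin_cases l'
  · exact le_rfl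
  · exact Phi_glue_zero_le_one hb hc hxb hxc
  · have h01 : (0 : Fin 3) ≤ 1 := by decide
    exact (Phi_glue_zero_le_one hb hc hxb hxc).trans (Phi_glue_one_le_two hb hc (up hb h01 hxb) (up hc h01 hxc))
  · exact absurd hll (by decide)
  · exact le_rfl
  · exact Phi_glue_one_le_two hb hc hxb hxc
  · exact absurd hll (by decide)
  · exact absurd hll (by decide)
  · exact le_rfl

end Axis

end Summit.CriticalPhenomena.PercolationContinuityZ3.Theorems.SahiLatin
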